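import Literature.MathematicalPhysics.QuantumFieldTheory.Balaban1983to89.B14From190SupSize
import Literature.MathematicalPhysics.QuantumFieldTheory.Balaban1983to89.B15LayerSupSize

/-!
# `Balaban1983to89.B14From190LayerSizes` — T. Bałaban, *Convergent renormalization expansions for lattice gauge theories*,
# Commun. Math. Phys. **119** (1988) 243–285 [Balaban1988Convergent] = [III]: the four (190)-knittings of §§1, 3 with the
# INPUT B-sizes of the argument fields ((3.17) `44d²B₃ε_{k+1}`; (3.6) `4δ_k` / `30d²L²B₃(1+β₀)ε_k`) DISCHARGED from p29's
# lattice theorems at the sup size `B11SupSize190.supSize`, and the localisation distances reduced to box geometry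

statement-level skeleton of published theorems with citation tags; proofs where landed; nothing here is a claim
about the Yang–Mills mass gap

CITATION HEADER (lean-in-tree rule 2026-08-18).  T. Bałaban, *Convergent renormalization expansions for lattice gauge
theories*, Commun. Math. Phys. **119**, 243–285 (1988), doi:10.1007/BF01217741, bib `Balaban1988Convergent` (cell paper
B14 = "[III]"; PDF held `paper:balaban1988-cmp119-convergent-renormalization`, pp. 250, 266, 268, 269 = PDF 8, 24, 26, 27;
the sentences used are quoted below from those pages).  "[15]" = [Balaban1985Variational] (190) p. 308 (`B11SectG.Ineq190`;
its sizes *"for x ∈ Δ(y)"* = `B11SupSize190.supSize`).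

WHAT IS REPRODUCED.  SKELETON rows **B14.Eq3.16–3.19**, **B14.Eq3.21–3.22**, **B14.Eq1.18–1.19**, **B14.Claim@265**
(mega-formalization `lit-balaban`, HOME `run/shared/lean/pub/lit-balaban/`, unit `lit-balaban-r11` gen 7, B14 fold owner).
p. 268: *"The field U_{k+1} satisfies the regularity condition |∂U_{k+1} − 1| < 2B₃ε_{k+1}(L⁻¹η)² on Ω_{k+1}, hence the
argument of the function 𝐇_{k+1,□′} is bounded by 44d²B₃ε_{k+1}, and has a support in a boundary layer of the width 2LMη
at the boundary of □′^{∼4}."*;  p. 266: *"On almost the whole cube □^{∼4}, except a boundary layer of the width 2Mη, the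
field in the argument of the function 𝐇_{k,□} is equal to (1/i)log[V_k(V^{(k)}_{□′})⁻¹], hence it can be bounded by 4δ_k.
On the boundary layer this field can be bounded by 30d²L²B₃(1+β₀)ε_k"*.  In r11's knittings (`B14Ineq319From190`,
`B14Eq322From190`, `B14Eq119From190`, `B14Ineq38From190`, and their sup-size forms `B14From190SupSize`) these two sentences
are the HYPOTHESES `hm : ∀ y′, bB.loc y′ B ≤ 44d²B₃ε_{k+1}` resp. `hm₁ : bB.loc y′ B₁ ≤ 4δ_k`, `hm₂ : bB.loc y′ B₂ ≤
30d²L²B₃(1+β₀)ε_k` on an ABSTRACT argument vector of an abstract input size `bB`, together with the localisation distances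
`hD : bB.loc y′ B ≠ 0 → D ≤ dist(y, y′)`.  p29 proved the sentences on the `ℤ^d` carriers (`B14ArgField36Lattice` p264453,
`B15LayerLocal` p266185) and, at the sup input size over ANY index set `X` of bonds of the cube tower, as
`B15LayerSupSize.loc_layer317_le` / `loc_argField36_printed_le` / `loc_top_le` (p266738).  THIS FILE COMPOSES, BY NAME:
`FB := X → 𝔸`, `bB := supSize g boxB blkB` (`boxB y′` = the bonds of the determining set read in block `y′`), `B :=` p29's
concrete tower field, the background `U₀ = U_{k+1,□′}` SHARED between the argument field and the consumer side.

WHAT THIS FILE PROVES (kernel-checked, zero `sorry`; no `def`, no new `Prop`, no new named fact; axioms standard).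
* (private) `exists_ne_zero_of_loc_ne_zero` — bookkeeping for `supSize`: a nonzero block size exhibits a nonzero value in
  the box (turns every localisation hypothesis `hD` into box geometry).
* `ineq319_lt_of_ineq190_layer` — (3.19) `|V^{(k)}(b)(V^{(k)}_{□′}(b))⁻¹ − 1| < δ_k` on the lattice model
  (`B14From190SupSize.ineq319_lt_lattice_of_ineq190_sup`) with `hm` DISCHARGED by `loc_layer317_le` for the (3.17) field
  `B i = (1/i)log[M^{K−j}(U₀)(b_i)((Q^{s*}_j M^K(U₀))(b_i))⁻¹]` (`j = dep i`) and `hD` REPLACED by `hfar : i ∈ boxB y′ → D ≤ dist y y′`.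
* `norm_bH322_le_of_ineq190_layer` — the p. 269 bound on `𝐇^{(k)}` likewise (`norm_bH322_le_lattice_of_ineq190_sup`).
* `dev119_le_of_ineq190_layer` — the p. 250 bound `|U₁U_{1,□′}⁻¹ − 1| ≤ O(1)B₃e^{−δLM₂R₁}44d²B₃ε₁` likewise (`k = 0`).
* `ineq38_lt_of_ineq190_layer` — (3.8) `|U_{k,□}(∂p) − 1| < ε_kη²` (`B14From190SupSize.ineq38_lt_lattice_of_ineq190_sizes`, both
  OUTPUT dictionaries already discharged there) with print's split of the (3.6) field realised on p29's tower field
  `F i = (1/i)log[(Q^{s*}_jV)(b_i)(M^{k−j}(U₀)(b_i))⁻¹]` as `B₁ :=` its top-type part (`dep i = 0`: *"equal to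
  (1/i)log[V_k(V^{(k)}_{□′})⁻¹], hence … 4δ_k"*, `argField36_top_lt` from (3.3), no localisation) `+ B₂ :=` its finer part
  (`dep i ≠ 0`: *"on the boundary layer … 30d²L²B₃(1+β₀)ε_k"*, `argField36_lt_printed_local`), `hD₂` REPLACED by `hfar : i ∈ boxB y′
  → dep i ≠ 0 → D ≤ dist y y′` (the finer bonds live in the far layer); `U₀ ∈ {|u| ≤ 1}` now from `AvgClosed.le_U1`.
* `ineq38_lt_of_ineq190_layer_scale` — the same at print's scale `η = L^{−k}`: the single (3.2) hypothesis
  `pdevOn (finest cube) U₀ < ε_{k+1}(L⁻¹η)²` feeds BOTH the input size and the consumer's plaquette deviation (`le_pdevOn`).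
HONEST SCOPE.  (1) What is discharged here is the INPUT side (`hm`, `hD` ↦ geometry, `κ = 1`); together with
`B14From190SupSize` (output side) the hypotheses LEFT in every B14 (190)-knit are exactly: [15] (190) itself for the
derivative functionals `dH t` (`Ineq190 (supSize g boxB blkB) (supSize g box blk) (dH t) C δ₀`, resp. the covariant-derivative
size), (2.61) `RowSum`, the mean-value reading `hmv`, the box/tower GEOMETRY (`hbox`, `hfar`, `hX`, `hgeom`), and the located
smallness / flow side conditions ((2.8)/(2.9), `hsmall`, …) in the printed shapes.  (2) The number of levels `K` of the
(3.17) tower (print: the levels of `𝐁_{k+1}` below `□′^{∼4}`) and the consumer's `k` are not identified; `U₀` is.  (3) p29's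
HONEST SCOPE carries over verbatim (regularity on the finest cube only, block-axial gauge `h15` on the tower, `AvgClosed`
value group, print's strict `<` sizes used as `≤`).  NOT summit progress.  r11 gen 7 (literature-prover-lit-balaban-r11-g7-0).
-/

noncomputable section

open scoped BigOperators
open NormedSpace Finset

namespace Literature.MathematicalPhysics.QuantumFieldTheory.Balaban1983to89.B14From190LayerSizes

open Literature.MathematicalPhysics.QuantumFieldTheory.Balaban1983to89
open MatrixLog B7Prop1Explicit B7Prop2Explicit B7Prop1Local B7Prop3Flat B7Eq92Concrete B7Eq162General B8Lemma1NonAbelian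
  B8Ineq129 B8Ineq130 B8Ineq165Descent B15Ineq184BlockAxial B15Ineq184Local B8Eq115GaugeFixing B14ArgField36Lattice
  B15LayerLocal B15LayerSupSize
open B11SectG B11SupSize190 B11SeminormSize190 B14Ineq38From190 B14Ineq319From190 B14Eq322From190 B14Eq119From190
  B14From190SupSize

variable {d : ℕ}

/-! ## §0 Bookkeeping: a nonzero sup size exhibits a nonzero value in the box -/

/-- If the sup size of `f` over `box y` is nonzero then some `f x`, `x ∈ box y`, is nonzero — so a localisation hypothesis
`loc y′ B ≠ 0 → D ≤ dist y y′` follows from the box geometry `x ∈ box y′ → (B x ≠ 0 →) D ≤ dist y y′`. [folklore] -/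
private theorem exists_ne_zero_of_loc_ne_zero {g : B6.Geometry} {X E : Type} [NormedAddCommGroup E] [Module ℝ E]
    {box : g.Site → Finset X} {blk : X → g.Site} {y : g.Site} {f : X → E}
    (h : (supSize g box blk : BlockNorm g (X → E)).loc y f ≠ 0) : ∃ x ∈ box y, f x ≠ 0 := by
  by_contra hc
  refine h (le_antisymm (loc_le_of_forall le_rfl fun x hx => ?_) ((supSize g box blk : BlockNorm g (X → E)).loc_nonneg y f))
  rw [Classical.not_not.1 (fun hx' => hc ⟨x, hx, hx'⟩), norm_zero]

/-! ## §1 (3.19), p. 269, p. 250: the (3.17)-type argument field, size `44d²B₃ε_{k+1}` from `loc_layer317_le` -/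

section NormedAlgebra

variable {g : B6.Geometry} {X : Type}
variable {𝔸 : Type} [NormedRing 𝔸] [NormedAlgebra ℂ 𝔸] [CompleteSpace 𝔸] [NormOneClass 𝔸]

/-- **(3.19) `< δ_k` ON THE LATTICE MODEL FROM [15] (190), INPUT AND OUTPUT SIZES CONCRETE** —
`B14From190SupSize.ineq319_lt_lattice_of_ineq190_sup` at `bB := supSize g boxB blkB` on the bond index set `X` of the (3.17)
tower (`dep`, `pt`, `dir`, `hX`), `B :=` the (3.17) field of `U₀`; `hm` DISCHARGED by `B15LayerSupSize.loc_layer317_le`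
(*"hence the argument of the function 𝐇_{k+1,□′} is bounded by 44d²B₃ε_{k+1}"*), `hD` REPLACED by `hfar` (*"has a support in a
boundary layer … at the boundary of □′^{∼4}"*: every block whose box carries a bond of the field is `≥ D` from `y`), `κ = 1`.
[cite: Balaban1988Convergent, (3.17)-(3.19) p.268; Balaban1985Variational, (190) p.308] -/
theorem ineq319_lt_of_ineq190_layer
    (boxB : g.Site → Finset X) (blkB : X → g.Site) (dep : X → ℕ) (pt : X → B7Prop1Explicit.Site d) (dir : X → Fin d)
    (box : g.Site → Finset (B7Prop1Explicit.Site d)) (blk : B7Prop1Explicit.Site d → g.Site)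
    {T : Type*} {dH : T → (X → 𝔸) →ₗ[ℝ] (B7Prop1Explicit.Site d → Fin d → 𝔸)} {C δ₀ σ τ c D : ℝ}
    (h190 : ∀ t, Ineq190 (supSize (X := X) (E := 𝔸) g boxB blkB)
      (supSize (X := B7Prop1Explicit.Site d) (E := Fin d → 𝔸) g box blk) (dH t) C δ₀)
    (hC : 0 ≤ C) (hdist : ∀ a b : g.Site, 0 ≤ g.dist a b)
    (hrow : RowSum g σ c) (hτ : 0 ≤ τ) (hστ : σ + τ ≤ δ₀ / 8) (y : g.Site)
    {B₃ δ M₂ R1 R β₀ A₀ A₁ ε εk1 δk : ℝ}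
    -- the (3.17) tower of p29 (`B15LayerSupSize.loc_layer317_le`), background `U₀`
    {L : ℕ} (hL : 2 ≤ L) (hd1 : 1 ≤ d) {G : Subgroup 𝔸ˣ} (hG : AvgClosed d L G) (K : ℕ)
    {U₀ : B7Prop1Explicit.Site d → Fin d → 𝔸ˣ} (hU₀ : ∀ x κ, U₀ x κ ∈ G) (hB₃ : 0 < B₃) (hε1 : 0 < εk1)
    (hs3 : C0 d * (2 * B₃ * εk1) ≤ 1 / 3) (hs2 : 2 * (2 * B₃ * εk1) ≤ c2' d L)
    (hs : 11 * (d : ℝ) ^ 2 * (2 * B₃ * εk1) ≤ 1 / 6) (lo hi : B7Prop1Explicit.Site d) (hlohi : lo ≤ hi)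
    (h317 : pdevOn (tlo L lo K) (thi L hi K) U₀ < 2 * B₃ * εk1 * (((L : ℝ) ^ K)⁻¹) ^ 2)
    (h15 : ∀ n, n < K → ∀ z, tlo L lo n ≤ z → z ≤ thi L hi n → ∀ r : Fin d → Fin L,
      axialFn (avgIter L U₀ (K - (n + 1))) ((L : ℤ) • z) ((L : ℤ) • z + boxVec L r) = 1)
    (hX : ∀ i, dep i ≤ K ∧ tlo L lo (dep i) ≤ pt i ∧ pt i + e (dir i) ≤ thi L hi (dep i))
    -- localisation, now geometry: the blocks carrying bonds of the field are `≥ D` away from `y`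
    (hfar : ∀ y' i, i ∈ boxB y' → D ≤ g.dist y y')
    {Hf : B7Prop1Explicit.Site d → Fin d → 𝔸}
    (hmv : ∀ s : ℝ, (∀ t, (supSize (X := B7Prop1Explicit.Site d) (E := Fin d → 𝔸) g box blk).loc y (dH t
        (fun i => mlog (((avgIter L U₀ (K - dep i) (pt i) (dir i) *
          (pullIter L (avgIter L U₀ K) (dep i) (pt i) (dir i))⁻¹ : 𝔸ˣ) : 𝔸)))) ≤ s) →
      (supSize (X := B7Prop1Explicit.Site d) (E := Fin d → 𝔸) g box blk).loc y Hf ≤ s)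
    {k : ℕ} {α₀ : ℝ} (hα : 0 < α₀)
    (hα3 : C0 d * α₀ ≤ 1 / 3) (hα4 : 4 * α₀ ≤ c2' d L) (h52 : pdev U₀ < α₀ * (((L : ℝ) ^ k)⁻¹) ^ 2)
    (q : B7Prop1Explicit.Site d) (κ : Fin d)
    (hgeom : δ * L * M₂ * R1 ≤ τ * D) (hCB : C * c ≤ B₃)
    (hflow : εk1 ≤ (1 + β₀) * ε) (hRR : R ≤ δ * L * M₂ * R1)
    (hbox : ∀ y', B7Prop1Local.InBox (B7Prop1Local.loK L k q) (B7Prop1Local.bondHiK L k q κ) y' → y' ∈ box y)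
    (hβ₀ : 0 ≤ 1 + β₀) (hε : 0 ≤ ε) (hδk : 0 < δk) (hεδ : ε = A₀ / A₁ * δk)
    (hsmall : Real.exp (4 * (800 * ((d : ℝ) + 1) ^ 2 * ((d : ℝ) + 4)) * α₀)
      * (1 + 8 * (131072 * ((d : ℝ) + 1) ^ 2) * (44 * (d : ℝ) ^ 2 * B₃ ^ 2 * (1 + β₀) * Real.exp (-R) * ε)) ≤ 2)
    (hc₃ : 2 * (44 * (d : ℝ) ^ 2 * B₃ ^ 2 * (1 + β₀) * Real.exp (-R) * ε) ≤ c3 d L)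
    (hsm : 2048 * (d : ℝ) * (44 * (d : ℝ) ^ 2 * B₃ ^ 2 * (1 + β₀) * Real.exp (-R) * ε) ≤ 1)
    (h1 : 128 * (44 * (d : ℝ) ^ 2 * B₃ ^ 2 * (1 + β₀) * Real.exp (-R) * ε) ≤ 1)
    (hgk : (68 * ((d : ℝ) + 1) + 160 * d) * 44 * (d : ℝ) ^ 2 * B₃ ^ 2 * (1 + β₀) * (A₀ / A₁) * Real.exp (-R) < 1)
    (hL1 : 1 ≤ L) :
    ‖((avgIter L
          (gaugeAct (B7Eq84Concrete.glev L hL1 U₀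
              (expCfg (fun z μ => ((Complex.I : ℂ) * ((((L : ℝ) ^ (k + 1))⁻¹ : ℝ) : ℂ)) • Hf z μ)) k 0)⁻¹
            (expCfg (fun z μ => ((Complex.I : ℂ) * ((((L : ℝ) ^ (k + 1))⁻¹ : ℝ) : ℂ)) • Hf z μ) * U₀)) k q κ : 𝔸ˣ) : 𝔸)
        * (((avgIter L U₀ k q κ)⁻¹ : 𝔸ˣ) : 𝔸) - 1‖ < δk :=
  ineq319_lt_lattice_of_ineq190_sup box blk h190 hC hdist hrow hτ hστ _ y
    (loc_layer317_le boxB blkB dep pt dir L hL hd1 hG K U₀ hU₀ hB₃ hε1 hs3 hs2 hs lo hi hlohi h317 h15 hX)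
    (fun y' hne => by obtain ⟨i, hi, -⟩ := exists_ne_zero_of_loc_ne_zero hne; exact hfar y' i hi)
    hmv hL hG hU₀ hα hα3 hα4 h52 q κ hgeom (by rw [supSize_κ, mul_one]; exact hCB) hB₃.le hε1.le hflow hRR hbox hβ₀ hε
    hδk hεδ hsmall hc₃ hsm h1 hgk hL1

/-- **p. 269, the bound on `𝐇^{(k)}`, INPUT AND OUTPUT SIZES CONCRETE** — `B14From190SupSize.norm_bH322_le_lattice_of_ineq190_sup`
with the (3.17)-type argument field of `U₀`, `hm` DISCHARGED by `loc_layer317_le`, `hD` ↦ `hfar`, `κ = 1`.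
[cite: Balaban1988Convergent, (3.22) p.269, (3.17) p.268; Balaban1985Variational, (190) p.308] -/
theorem norm_bH322_le_of_ineq190_layer
    (boxB : g.Site → Finset X) (blkB : X → g.Site) (dep : X → ℕ) (pt : X → B7Prop1Explicit.Site d) (dir : X → Fin d)
    (box : g.Site → Finset (B7Prop1Explicit.Site d)) (blk : B7Prop1Explicit.Site d → g.Site)
    {T : Type*} {dH : T → (X → 𝔸) →ₗ[ℝ] (B7Prop1Explicit.Site d → Fin d → 𝔸)} {C δ₀ σ τ c D : ℝ}
    (h190 : ∀ t, Ineq190 (supSize (X := X) (E := 𝔸) g boxB blkB)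
      (supSize (X := B7Prop1Explicit.Site d) (E := Fin d → 𝔸) g box blk) (dH t) C δ₀)
    (hC : 0 ≤ C) (hdist : ∀ a b : g.Site, 0 ≤ g.dist a b)
    (hrow : RowSum g σ c) (hτ : 0 ≤ τ) (hστ : σ + τ ≤ δ₀ / 8) (y : g.Site)
    {B₃ δ M₂ R1 R β₀ ε εk1 : ℝ}
    {L : ℕ} (hL : 2 ≤ L) (hd1 : 1 ≤ d) {G : Subgroup 𝔸ˣ} (hG : AvgClosed d L G) (K : ℕ)
    {U₀ : B7Prop1Explicit.Site d → Fin d → 𝔸ˣ} (hU₀ : ∀ x κ, U₀ x κ ∈ G) (hB₃ : 0 < B₃) (hε1 : 0 < εk1)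
    (hs3 : C0 d * (2 * B₃ * εk1) ≤ 1 / 3) (hs2 : 2 * (2 * B₃ * εk1) ≤ c2' d L)
    (hs : 11 * (d : ℝ) ^ 2 * (2 * B₃ * εk1) ≤ 1 / 6) (lo hi : B7Prop1Explicit.Site d) (hlohi : lo ≤ hi)
    (h317 : pdevOn (tlo L lo K) (thi L hi K) U₀ < 2 * B₃ * εk1 * (((L : ℝ) ^ K)⁻¹) ^ 2)
    (h15 : ∀ n, n < K → ∀ z, tlo L lo n ≤ z → z ≤ thi L hi n → ∀ r : Fin d → Fin L,
      axialFn (avgIter L U₀ (K - (n + 1))) ((L : ℤ) • z) ((L : ℤ) • z + boxVec L r) = 1)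
    (hX : ∀ i, dep i ≤ K ∧ tlo L lo (dep i) ≤ pt i ∧ pt i + e (dir i) ≤ thi L hi (dep i))
    (hfar : ∀ y' i, i ∈ boxB y' → D ≤ g.dist y y')
    {Hf : B7Prop1Explicit.Site d → Fin d → 𝔸}
    (hmv : ∀ s : ℝ, (∀ t, (supSize (X := B7Prop1Explicit.Site d) (E := Fin d → 𝔸) g box blk).loc y (dH t
        (fun i => mlog (((avgIter L U₀ (K - dep i) (pt i) (dir i) *
          (pullIter L (avgIter L U₀ K) (dep i) (pt i) (dir i))⁻¹ : 𝔸ˣ) : 𝔸)))) ≤ s) →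
      (supSize (X := B7Prop1Explicit.Site d) (E := Fin d → 𝔸) g box blk).loc y Hf ≤ s)
    {k : ℕ} {α₀ : ℝ} (hα : 0 < α₀)
    (hα3 : C0 d * α₀ ≤ 1 / 3) (hα4 : 4 * α₀ ≤ c2' d L) (h52 : pdev U₀ < α₀ * (((L : ℝ) ^ k)⁻¹) ^ 2)
    (q : B7Prop1Explicit.Site d) (κ : Fin d)
    (hgeom : δ * L * M₂ * R1 ≤ τ * D) (hCB : C * c ≤ B₃)
    (hflow : εk1 ≤ (1 + β₀) * ε) (hRR : R ≤ δ * L * M₂ * R1)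
    (hbox : ∀ y', B7Prop1Local.InBox (B7Prop1Local.loK L k q) (B7Prop1Local.bondHiK L k q κ) y' → y' ∈ box y)
    (hβ₀ : 0 ≤ 1 + β₀) (hε : 0 ≤ ε)
    (hsmall : Real.exp (4 * (800 * ((d : ℝ) + 1) ^ 2 * ((d : ℝ) + 4)) * α₀)
      * (1 + 8 * (131072 * ((d : ℝ) + 1) ^ 2) * (44 * (d : ℝ) ^ 2 * B₃ ^ 2 * (1 + β₀) * Real.exp (-R) * ε)) ≤ 2)
    (hc₃ : 2 * (44 * (d : ℝ) ^ 2 * B₃ ^ 2 * (1 + β₀) * Real.exp (-R) * ε) ≤ c3 d L)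
    (hsm : 2048 * (d : ℝ) * (44 * (d : ℝ) ^ 2 * B₃ ^ 2 * (1 + β₀) * Real.exp (-R) * ε) ≤ 1)
    (h1 : 128 * (44 * (d : ℝ) ^ 2 * B₃ ^ 2 * (1 + β₀) * Real.exp (-R) * ε) ≤ 1) (hL1 : 1 ≤ L)
    (hsO : (68 * ((d : ℝ) + 1) + 160 * d) * 44 * (d : ℝ) ^ 2 * B₃ ^ 2 * (1 + β₀) * ε * Real.exp (-R) ≤ 1 / 2) :
    ‖B14.Eq316.bH (avgIter L
          (gaugeAct (B7Eq84Concrete.glev L hL1 U₀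
              (expCfg (fun z μ => ((Complex.I : ℂ) * ((((L : ℝ) ^ (k + 1))⁻¹ : ℝ) : ℂ)) • Hf z μ)) k 0)⁻¹
            (expCfg (fun z μ => ((Complex.I : ℂ) * ((((L : ℝ) ^ (k + 1))⁻¹ : ℝ) : ℂ)) • Hf z μ) * U₀)) k q κ)
        (avgIter L U₀ k q κ)‖
      ≤ 2 * ((68 * ((d : ℝ) + 1) + 160 * d) * 44 * (d : ℝ) ^ 2 * B₃ ^ 2 * (1 + β₀)) * ε * Real.exp (-R) :=
  norm_bH322_le_lattice_of_ineq190_sup box blk h190 hC hdist hrow hτ hστ _ y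
    (loc_layer317_le boxB blkB dep pt dir L hL hd1 hG K U₀ hU₀ hB₃ hε1 hs3 hs2 hs lo hi hlohi h317 h15 hX)
    (fun y' hne => by obtain ⟨i, hi, -⟩ := exists_ne_zero_of_loc_ne_zero hne; exact hfar y' i hi)
    hmv hL hG hU₀ hα hα3 hα4 h52 q κ hgeom (by rw [supSize_κ, mul_one]; exact hCB) hB₃.le hε1.le hflow hRR hbox hβ₀ hε
    hsmall hc₃ hsm h1 hL1 hsO

/-- **p. 250, `|U₁U_{1,□′}⁻¹ − 1| ≤ O(1)B₃e^{−δLM₂R₁}·44d²B₃ε₁`, INPUT AND OUTPUT SIZES CONCRETE** —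
`B14From190SupSize.dev119_le_lattice_of_ineq190_sup` (`k = 0`) with the (1.18)/(3.17)-type argument field of `U₀` on a tower of
`K` levels, `hm` (`44d²B₃ε₁`) DISCHARGED by `loc_layer317_le` at `ε_{k+1} := ε₁`, `hD` ↦ `hfar`, `κ = 1`.
[cite: Balaban1988Convergent, (1.18)-(1.19) p.250, (3.17) p.268; Balaban1985Variational, (190) p.308] -/
theorem dev119_le_of_ineq190_layer
    (boxB : g.Site → Finset X) (blkB : X → g.Site) (dep : X → ℕ) (pt : X → B7Prop1Explicit.Site d) (dir : X → Fin d)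
    (box : g.Site → Finset (B7Prop1Explicit.Site d)) (blk : B7Prop1Explicit.Site d → g.Site)
    {T : Type*} {dH : T → (X → 𝔸) →ₗ[ℝ] (B7Prop1Explicit.Site d → Fin d → 𝔸)} {C δ₀ σ τ c D : ℝ}
    (h190 : ∀ t, Ineq190 (supSize (X := X) (E := 𝔸) g boxB blkB)
      (supSize (X := B7Prop1Explicit.Site d) (E := Fin d → 𝔸) g box blk) (dH t) C δ₀)
    (hC : 0 ≤ C) (hdist : ∀ a b : g.Site, 0 ≤ g.dist a b)
    (hrow : RowSum g σ c) (hτ : 0 ≤ τ) (hστ : σ + τ ≤ δ₀ / 8) (y : g.Site)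
    {B₃ δ M₂ R₁ ε₁ : ℝ}
    {L : ℕ} (hL : 2 ≤ L) (hd1 : 1 ≤ d) {G : Subgroup 𝔸ˣ} (hG : AvgClosed d L G) (K : ℕ)
    {U₀ : B7Prop1Explicit.Site d → Fin d → 𝔸ˣ} (hU₀ : ∀ x κ, U₀ x κ ∈ G) (hB₃ : 0 < B₃) (hε1 : 0 < ε₁)
    (hs3 : C0 d * (2 * B₃ * ε₁) ≤ 1 / 3) (hs2 : 2 * (2 * B₃ * ε₁) ≤ c2' d L)
    (hs : 11 * (d : ℝ) ^ 2 * (2 * B₃ * ε₁) ≤ 1 / 6) (lo hi : B7Prop1Explicit.Site d) (hlohi : lo ≤ hi)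
    (h317 : pdevOn (tlo L lo K) (thi L hi K) U₀ < 2 * B₃ * ε₁ * (((L : ℝ) ^ K)⁻¹) ^ 2)
    (h15 : ∀ n, n < K → ∀ z, tlo L lo n ≤ z → z ≤ thi L hi n → ∀ r : Fin d → Fin L,
      axialFn (avgIter L U₀ (K - (n + 1))) ((L : ℤ) • z) ((L : ℤ) • z + boxVec L r) = 1)
    (hX : ∀ i, dep i ≤ K ∧ tlo L lo (dep i) ≤ pt i ∧ pt i + e (dir i) ≤ thi L hi (dep i))
    (hfar : ∀ y' i, i ∈ boxB y' → D ≤ g.dist y y')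
    {Hf : B7Prop1Explicit.Site d → Fin d → 𝔸}
    (hmv : ∀ s : ℝ, (∀ t, (supSize (X := B7Prop1Explicit.Site d) (E := Fin d → 𝔸) g box blk).loc y (dH t
        (fun i => mlog (((avgIter L U₀ (K - dep i) (pt i) (dir i) *
          (pullIter L (avgIter L U₀ K) (dep i) (pt i) (dir i))⁻¹ : 𝔸ˣ) : 𝔸)))) ≤ s) →
      (supSize (X := B7Prop1Explicit.Site d) (E := Fin d → 𝔸) g box blk).loc y Hf ≤ s)
    {α₀ : ℝ} (hα : 0 < α₀)
    (hα3 : C0 d * α₀ ≤ 1 / 3) (hα4 : 4 * α₀ ≤ c2' d L) (h52 : pdev U₀ < α₀ * (((L : ℝ) ^ 0)⁻¹) ^ 2)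
    (q : B7Prop1Explicit.Site d) (κ : Fin d)
    (hgeom : δ * L * M₂ * R₁ ≤ τ * D) (hCB : C * c ≤ B₃)
    (hbox : ∀ y', B7Prop1Local.InBox (B7Prop1Local.loK L 0 q) (B7Prop1Local.bondHiK L 0 q κ) y' → y' ∈ box y)
    (hsmall : Real.exp (4 * (800 * ((d : ℝ) + 1) ^ 2 * ((d : ℝ) + 4)) * α₀)
      * (1 + 8 * (131072 * ((d : ℝ) + 1) ^ 2) * (B₃ * Real.exp (-(δ * L * M₂ * R₁)) * (44 * (d : ℝ) ^ 2 * B₃) * ε₁)) ≤ 2)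
    (hc₃ : 2 * (B₃ * Real.exp (-(δ * L * M₂ * R₁)) * (44 * (d : ℝ) ^ 2 * B₃) * ε₁) ≤ c3 d L)
    (hsm : 2048 * (d : ℝ) * (B₃ * Real.exp (-(δ * L * M₂ * R₁)) * (44 * (d : ℝ) ^ 2 * B₃) * ε₁) ≤ 1)
    (h1 : 128 * (B₃ * Real.exp (-(δ * L * M₂ * R₁)) * (44 * (d : ℝ) ^ 2 * B₃) * ε₁) ≤ 1) (hL1 : 1 ≤ L) :
    ‖((avgIter L
          (gaugeAct (B7Eq84Concrete.glev L hL1 U₀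
              (expCfg (fun z μ => ((Complex.I : ℂ) * ((((L : ℝ) ^ (0 + 1))⁻¹ : ℝ) : ℂ)) • Hf z μ)) 0 0)⁻¹
            (expCfg (fun z μ => ((Complex.I : ℂ) * ((((L : ℝ) ^ (0 + 1))⁻¹ : ℝ) : ℂ)) • Hf z μ) * U₀)) 0 q κ : 𝔸ˣ) : 𝔸)
        * (((avgIter L U₀ 0 q κ)⁻¹ : 𝔸ˣ) : 𝔸) - 1‖
      ≤ (68 * ((d : ℝ) + 1) + 160 * d) * (B₃ * Real.exp (-(δ * L * M₂ * R₁)) * (44 * (d : ℝ) ^ 2 * B₃) * ε₁) :=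
  dev119_le_lattice_of_ineq190_sup box blk h190 hC hdist hrow hτ hστ _ y
    (loc_layer317_le boxB blkB dep pt dir L hL hd1 hG K U₀ hU₀ hB₃ hε1 hs3 hs2 hs lo hi hlohi h317 h15 hX)
    (fun y' hne => by obtain ⟨i, hi, -⟩ := exists_ne_zero_of_loc_ne_zero hne; exact hfar y' i hi)
    hmv hL hG hU₀ hα hα3 hα4 h52 q κ hgeom (by rw [supSize_κ, mul_one]; exact hCB) hB₃.le hbox hsmall hc₃ hsm h1 hL1

end NormedAlgebra

/-! ## §2 (3.8): the (3.6) field split by depth — top-type bonds `4δ_k` (anywhere) + finer layer bonds `30d²L²B₃(1+β₀)ε_k` (far) -/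

section CStar

variable {gB : B6.Geometry} {X : Type}
variable {𝔸 : Type} [CStarAlgebra 𝔸] [Nontrivial 𝔸]

/-- **(3.8) ⇒ "Thus χ_k(□) = 1" ON THE LATTICE MODEL FROM [15] (190), ALL FOUR SIZES CONCRETE** —
`B14From190SupSize.ineq38_lt_lattice_of_ineq190_sizes` (output sizes `supSize gB box blk` and `covDerivBlockSize gB y₀ S η U₀`,
dictionaries = set membership) at the INPUT size `bB := supSize gB boxB blkB` on the bond index set `X` of p29's (3.6) tower
(`B14ArgField36Lattice` / `B15LayerLocal`: top field `V = V_k`, background `U₀ = U_{k+1,□′}`, `F i = (1/i)log[(Q^{s*}_jV)(b_i)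
(M^{k−j}(U₀)(b_i))⁻¹]`, `j = dep i`), with print's split: `B₁ := F` on the top-type bonds (`dep i = 0`; *"equal to
(1/i)log[V_k(V^{(k)}_{□′})⁻¹], hence it can be bounded by 4δ_k"* — `argField36_top_lt` from (3.3) `h33`), `B₂ := F` on the
finer bonds (`dep i ≠ 0`; *"On the boundary layer this field can be bounded by 30d²L²B₃(1+β₀)ε_k"* —
`argField36_lt_printed_local` from (3.2) `h32`, (2.8), `δ_k ≤ ε_k`, `B₃ ≥ 1`), `B₁ + B₂ = F`; `hm₁`, `hm₂` DISCHARGED, `hD₂` ↦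
`hfar` (blocks whose box carries a finer bond are `≥ D` from `y`), `κ = 1`, `U₀ ∈ {|u| ≤ 1}` from `AvgClosed.le_U1`.
[cite: Balaban1988Convergent, (3.6)-(3.8) p.266, (3.2)-(3.3) p.265; Balaban1985Variational, (190) p.308] -/
theorem ineq38_lt_of_ineq190_layer
    (boxB : gB.Site → Finset X) (blkB : X → gB.Site) (dep : X → ℕ) (pt : X → B7Prop1Explicit.Site d) (dir : X → Fin d)
    (box : gB.Site → Finset (B7Prop1Explicit.Site d)) (blk : B7Prop1Explicit.Site d → gB.Site)
    (y₀ : gB.Site) (S : gB.Site → Finset (B7Prop1Explicit.Site d × Fin d × Fin d))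
    {T : Type*} {dH : T → (X → 𝔸) →ₗ[ℝ] (B7Prop1Explicit.Site d → Fin d → 𝔸)}
    {C δ₀ σ τ c D B₃ δ M₂ R δk β₀ A₀ A₁ εk εk1 : ℝ}
    {η : ℝ} {U₀ : B7Prop1Explicit.Site d → Fin d → 𝔸ˣ}
    (h190₀ : ∀ t, Ineq190 (supSize (X := X) (E := 𝔸) gB boxB blkB)
      (supSize (X := B7Prop1Explicit.Site d) (E := Fin d → 𝔸) gB box blk) (dH t) C δ₀)
    (h190₁ : ∀ t, Ineq190 (supSize (X := X) (E := 𝔸) gB boxB blkB) (covDerivBlockSize gB y₀ S η U₀) (dH t) C δ₀)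
    (hC : 0 ≤ C) (hdist : ∀ a b : gB.Site, 0 ≤ gB.dist a b) (hrow : RowSum gB σ c) (hτ : 0 ≤ τ) (hστ : σ + τ ≤ δ₀ / 8)
    (y : gB.Site) (hη : 0 < η) (hη1 : η ≤ 1)
    -- the (3.6) tower of p29, background `U₀`, top field `V`
    {L : ℕ} (hL : 2 ≤ L) (hd1 : 1 ≤ d) {G : Subgroup 𝔸ˣ} (hG : AvgClosed d L G) (k : ℕ)
    (hU₀ : ∀ x κ, U₀ x κ ∈ G) (hε : 0 < εk) (hε' : 0 < εk1) (hflow : εk1 ≤ (1 + β₀) * εk) (hβ₀ : 0 ≤ β₀)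
    (hB₃ : 1 ≤ B₃) (hδ0 : 0 ≤ δk) (hδε : δk ≤ εk)
    (hs3 : C0 d * εk1 ≤ 1 / 3) (hs2 : 2 * εk1 ≤ c2' d L) (hs : 2 * δk + 11 * (d : ℝ) ^ 2 * εk1 ≤ 1 / 6)
    (lo hi : B7Prop1Explicit.Site d) (hlohi : lo ≤ hi)
    (h32 : pdevOn (tlo L lo k) (thi L hi k) U₀ < εk1 * ((L : ℝ)⁻¹ * ((L : ℝ) ^ k)⁻¹) ^ 2)
    (V : B7Prop1Explicit.Site d → Fin d → 𝔸ˣ) (hV : ∀ x μ, V x μ ∈ U1 𝔸)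
    (h15 : ∀ n, n < k → ∀ z, tlo L lo n ≤ z → z ≤ thi L hi n → ∀ r : Fin d → Fin L,
      axialFn (avgIter L U₀ (k - (n + 1))) ((L : ℤ) • z) ((L : ℤ) • z + boxVec L r) = 1)
    (hδ2 : 2 * δk ≤ 1 / 2)
    (h33 : ∀ x ν, lo ≤ x → x + e ν ≤ hi → ‖((V x ν * (avgIter L U₀ k x ν)⁻¹ : 𝔸ˣ) : 𝔸) - 1‖ < 2 * δk)
    (hX : ∀ i, dep i ≤ k ∧ tlo L lo (dep i) ≤ pt i ∧ pt i + e (dir i) ≤ thi L hi (dep i))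
    -- localisation, now geometry: the finer bonds live in the far boundary layer
    (hfar : ∀ y' i, i ∈ boxB y' → dep i ≠ 0 → D ≤ gB.dist y y')
    -- the consumer side ((3.8) for the plaquette `p_{μν}(x)`)
    {H : B7Prop1Explicit.Site d → Fin d → 𝔸} (hH : ∀ z κ, IsSelfAdjoint (H z κ))
    {u : B7Prop1Explicit.Site d → 𝔸ˣ} (hu : ∀ z, u z ∈ U1 𝔸) (μ ν : Fin d) (x : B7Prop1Explicit.Site d)
    (hmv₀ : ∀ s : ℝ, (∀ t, (supSize (X := B7Prop1Explicit.Site d) (E := Fin d → 𝔸) gB box blk).loc y (dH t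
        (fun i => mlog (((pullIter L V (dep i) (pt i) (dir i) *
          (avgIter L U₀ (k - dep i) (pt i) (dir i))⁻¹ : 𝔸ˣ) : 𝔸)))) ≤ s) →
      (supSize (X := B7Prop1Explicit.Site d) (E := Fin d → 𝔸) gB box blk).loc y H ≤ s)
    (hmv₁ : ∀ s : ℝ, (∀ t, (covDerivBlockSize gB y₀ S η U₀).loc y (dH t
        (fun i => mlog (((pullIter L V (dep i) (pt i) (dir i) *
          (avgIter L U₀ (k - dep i) (pt i) (dir i))⁻¹ : 𝔸ˣ) : 𝔸)))) ≤ s) →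
      (covDerivBlockSize gB y₀ S η U₀).loc y H ≤ s)
    (hgeom : 2 * δ * M₂ * R ≤ τ * D) (hCB : C * c ≤ B₃)
    (hδkε : δk = A₁ / A₀ * εk) (hM : 1 ≤ 2 * δ * M₂) (hR : 0 ≤ R)
    (h10 : 4 * B₃ * A₁ / A₀ + 30 * (d : ℝ) ^ 2 * (L : ℝ) ^ 2 * B₃ ^ 2 * (1 + β₀) * Real.exp (-R) < 1/10)
    (hx : x ∈ box y) (hxμ : x + e μ ∈ box y) (hxν : x + e ν ∈ box y)
    (hS₁ : (x, μ, ν) ∈ S y) (hS₂ : (x, ν, μ) ∈ S y)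
    (hε1 : εk ≤ 1) (hrestr : 2 * (1 + β₀) * (L : ℝ)⁻¹ ^ 2 + 4/10 < 1)
    (hdev₀ : ‖B8Ineq132.plaqF U₀ μ ν x - 1‖ < εk1 * ((L : ℝ)⁻¹ * η) ^ 2) :
    ‖B8Ineq132.plaqF (gaugeAct u (B8Lemma1NonAbelian.mulCfg (B8Eq146AExpansion.expCfg
        (B8Eq146AExpansion.iEta η H)) U₀)) μ ν x - 1‖ < εk * η ^ 2 := by
  -- print's split of the (3.6) field, realised by depth on p29's tower field `F`
  set F : X → 𝔸 := fun i => mlog (((pullIter L V (dep i) (pt i) (dir i) *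
    (avgIter L U₀ (k - dep i) (pt i) (dir i))⁻¹ : 𝔸ˣ) : 𝔸)) with hF
  have hsplit : (fun i => if dep i = 0 then F i else 0) + (fun i => if dep i = 0 then 0 else F i) = F := by
    funext i
    simp only [Pi.add_apply]
    split_ifs <;> simp
  have hB0 : (0 : ℝ) ≤ B₃ := zero_le_one.trans hB₃
  -- `hm₁`: on the top-type bonds the field is `(1/i)log[V(b)(M^k(U₀)(b))⁻¹]`, `< 4δ_k` by (3.3) (`argField36_top_lt`)
  have hm₁ : ∀ y', (supSize (X := X) (E := 𝔸) gB boxB blkB).loc y' (fun i => if dep i = 0 then F i else 0) ≤ 4 * δk :=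
    fun y' => loc_le_of_forall (by positivity) fun i _ => by
      by_cases h0 : dep i = 0
      · obtain ⟨-, hlo, hhi⟩ := hX i
        rw [h0, tlo_zero] at hlo
        rw [h0, thi_zero] at hhi
        simp only [h0, if_true, hF, pullIter_zero, Nat.sub_zero]
        exact (argField36_top_lt _ _ hδ2 (h33 (pt i) (dir i) hlo hhi)).le
      · simp only [h0, if_false, norm_zero]
        positivity
  -- `hm₂`: on the finer bonds the printed layer size (`argField36_lt_printed_local`)
  have hm₂ : ∀ y', (supSize (X := X) (E := 𝔸) gB boxB blkB).loc y' (fun i => if dep i = 0 then 0 else F i) ≤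
      30 * (d : ℝ) ^ 2 * (L : ℝ) ^ 2 * B₃ * (1 + β₀) * εk :=
    fun y' => loc_le_of_forall (by positivity) fun i _ => by
      by_cases h0 : dep i = 0
      · simp only [h0, if_true, norm_zero]
        positivity
      · simp only [h0, if_false, hF]
        exact (argField36_lt_printed_local L hL hd1 hG k U₀ hU₀ hε hε' hflow hβ₀ hB₃ hδ0 hδε hs3 hs2 hs lo hi hlohi h32
          V hV h15 h33 (dep i) (hX i).1 (pt i) (dir i) (hX i).2.1 (hX i).2.2).le
  -- `hD₂`: a nonzero size of the finer part exhibits a finer bond in the box, which is far by `hfar`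
  have hD₂ : ∀ y', (supSize (X := X) (E := 𝔸) gB boxB blkB).loc y' (fun i => if dep i = 0 then 0 else F i) ≠ 0 →
      D ≤ gB.dist y y' := fun y' hne => by
    obtain ⟨i, hi, hne'⟩ := exists_ne_zero_of_loc_ne_zero hne
    by_cases h0 : dep i = 0
    · exact absurd (by simp only [h0, if_true]) hne'
    · exact hfar y' i hi h0
  have h₀ : ∀ z κ, U₀ z κ ∈ U1 𝔸 := fun z κ => hG.le_U1 (hU₀ z κ)
  have hLpos : (0 : ℝ) < L := by exact_mod_cast (show 0 < L by omega)
  exact ineq38_lt_lattice_of_ineq190_sizes box blk y₀ S h190₀ h190₁ hC hdist hrow hτ hστ y hη hη1 h₀ hH hu μ ν x hm₁ hm₂ hD₂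
    (fun s hs' => hmv₀ s fun t => by simpa only [hsplit] using hs' t)
    (fun s hs' => hmv₁ s fun t => by simpa only [hsplit] using hs' t)
    hgeom (by rw [supSize_κ, mul_one]; exact hCB) hB0 (by linarith) hδkε hM hR h10 hx hxμ hxν hS₁ hS₂ hε hε1 hLpos hε'
    hflow hrestr hdev₀

/-- **(3.8) AT PRINT'S SCALE `η = L^{−k}`** — `ineq38_lt_of_ineq190_layer` with `η := (L^k)⁻¹`: the consumer's plaquette
deviation `|U₀(∂p_{μν}(x)) − 1| < ε_{k+1}(L⁻¹η)²` is then the SAME (3.2) hypothesis `h32` that sizes the argument field, read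
on the plaquette `p_{μν}(x)` of the finest cube (`B7Prop1Local.le_pdevOn`). [cite: Balaban1988Convergent, (3.2) p.265, (3.8) p.266] -/
theorem ineq38_lt_of_ineq190_layer_scale
    (boxB : gB.Site → Finset X) (blkB : X → gB.Site) (dep : X → ℕ) (pt : X → B7Prop1Explicit.Site d) (dir : X → Fin d)
    (box : gB.Site → Finset (B7Prop1Explicit.Site d)) (blk : B7Prop1Explicit.Site d → gB.Site)
    (y₀ : gB.Site) (S : gB.Site → Finset (B7Prop1Explicit.Site d × Fin d × Fin d))
    {T : Type*} {dH : T → (X → 𝔸) →ₗ[ℝ] (B7Prop1Explicit.Site d → Fin d → 𝔸)}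
    {C δ₀ σ τ c D B₃ δ M₂ R δk β₀ A₀ A₁ εk εk1 : ℝ}
    {L : ℕ} {k : ℕ} {U₀ : B7Prop1Explicit.Site d → Fin d → 𝔸ˣ}
    (h190₀ : ∀ t, Ineq190 (supSize (X := X) (E := 𝔸) gB boxB blkB)
      (supSize (X := B7Prop1Explicit.Site d) (E := Fin d → 𝔸) gB box blk) (dH t) C δ₀)
    (h190₁ : ∀ t, Ineq190 (supSize (X := X) (E := 𝔸) gB boxB blkB)
      (covDerivBlockSize gB y₀ S (((L : ℝ) ^ k)⁻¹) U₀) (dH t) C δ₀)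
    (hC : 0 ≤ C) (hdist : ∀ a b : gB.Site, 0 ≤ gB.dist a b) (hrow : RowSum gB σ c) (hτ : 0 ≤ τ) (hστ : σ + τ ≤ δ₀ / 8)
    (y : gB.Site)
    (hL : 2 ≤ L) (hd1 : 1 ≤ d) {G : Subgroup 𝔸ˣ} (hG : AvgClosed d L G)
    (hU₀ : ∀ x κ, U₀ x κ ∈ G) (hε : 0 < εk) (hε' : 0 < εk1) (hflow : εk1 ≤ (1 + β₀) * εk) (hβ₀ : 0 ≤ β₀)
    (hB₃ : 1 ≤ B₃) (hδ0 : 0 ≤ δk) (hδε : δk ≤ εk)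
    (hs3 : C0 d * εk1 ≤ 1 / 3) (hs2 : 2 * εk1 ≤ c2' d L) (hs : 2 * δk + 11 * (d : ℝ) ^ 2 * εk1 ≤ 1 / 6)
    (lo hi : B7Prop1Explicit.Site d) (hlohi : lo ≤ hi)
    (h32 : pdevOn (tlo L lo k) (thi L hi k) U₀ < εk1 * ((L : ℝ)⁻¹ * ((L : ℝ) ^ k)⁻¹) ^ 2)
    (V : B7Prop1Explicit.Site d → Fin d → 𝔸ˣ) (hV : ∀ x μ, V x μ ∈ U1 𝔸)
    (h15 : ∀ n, n < k → ∀ z, tlo L lo n ≤ z → z ≤ thi L hi n → ∀ r : Fin d → Fin L,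
      axialFn (avgIter L U₀ (k - (n + 1))) ((L : ℤ) • z) ((L : ℤ) • z + boxVec L r) = 1)
    (hδ2 : 2 * δk ≤ 1 / 2)
    (h33 : ∀ x ν, lo ≤ x → x + e ν ≤ hi → ‖((V x ν * (avgIter L U₀ k x ν)⁻¹ : 𝔸ˣ) : 𝔸) - 1‖ < 2 * δk)
    (hX : ∀ i, dep i ≤ k ∧ tlo L lo (dep i) ≤ pt i ∧ pt i + e (dir i) ≤ thi L hi (dep i))
    (hfar : ∀ y' i, i ∈ boxB y' → dep i ≠ 0 → D ≤ gB.dist y y')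
    {H : B7Prop1Explicit.Site d → Fin d → 𝔸} (hH : ∀ z κ, IsSelfAdjoint (H z κ))
    {u : B7Prop1Explicit.Site d → 𝔸ˣ} (hu : ∀ z, u z ∈ U1 𝔸) (μ ν : Fin d) (x : B7Prop1Explicit.Site d)
    (hmv₀ : ∀ s : ℝ, (∀ t, (supSize (X := B7Prop1Explicit.Site d) (E := Fin d → 𝔸) gB box blk).loc y (dH t
        (fun i => mlog (((pullIter L V (dep i) (pt i) (dir i) *
          (avgIter L U₀ (k - dep i) (pt i) (dir i))⁻¹ : 𝔸ˣ) : 𝔸)))) ≤ s) →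
      (supSize (X := B7Prop1Explicit.Site d) (E := Fin d → 𝔸) gB box blk).loc y H ≤ s)
    (hmv₁ : ∀ s : ℝ, (∀ t, (covDerivBlockSize gB y₀ S (((L : ℝ) ^ k)⁻¹) U₀).loc y (dH t
        (fun i => mlog (((pullIter L V (dep i) (pt i) (dir i) *
          (avgIter L U₀ (k - dep i) (pt i) (dir i))⁻¹ : 𝔸ˣ) : 𝔸)))) ≤ s) →
      (covDerivBlockSize gB y₀ S (((L : ℝ) ^ k)⁻¹) U₀).loc y H ≤ s)
    (hgeom : 2 * δ * M₂ * R ≤ τ * D) (hCB : C * c ≤ B₃)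
    (hδkε : δk = A₁ / A₀ * εk) (hM : 1 ≤ 2 * δ * M₂) (hR : 0 ≤ R)
    (h10 : 4 * B₃ * A₁ / A₀ + 30 * (d : ℝ) ^ 2 * (L : ℝ) ^ 2 * B₃ ^ 2 * (1 + β₀) * Real.exp (-R) < 1/10)
    (hx : x ∈ box y) (hxμ : x + e μ ∈ box y) (hxν : x + e ν ∈ box y)
    (hS₁ : (x, μ, ν) ∈ S y) (hS₂ : (x, ν, μ) ∈ S y)
    (hε1 : εk ≤ 1) (hrestr : 2 * (1 + β₀) * (L : ℝ)⁻¹ ^ 2 + 4/10 < 1)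
    -- the plaquette `p_{μν}(x)` lies in the finest cube of the tower
    (hp : PlaqIn (tlo L lo k) (thi L hi k) (x, μ, ν)) :
    ‖B8Ineq132.plaqF (gaugeAct u (B8Lemma1NonAbelian.mulCfg (B8Eq146AExpansion.expCfg
        (B8Eq146AExpansion.iEta (((L : ℝ) ^ k)⁻¹) H)) U₀)) μ ν x - 1‖ < εk * (((L : ℝ) ^ k)⁻¹) ^ 2 := by
  have hLpos : (0 : ℝ) < L := by exact_mod_cast (show 0 < L by omega)
  have hL1 : (1 : ℝ) ≤ L := by exact_mod_cast (show 1 ≤ L by omega)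
  have hη : (0 : ℝ) < ((L : ℝ) ^ k)⁻¹ := by positivity
  have hη1 : ((L : ℝ) ^ k)⁻¹ ≤ 1 := inv_le_one_of_one_le₀ (one_le_pow₀ hL1)
  have h₀ : ∀ z κ, U₀ z κ ∈ U1 𝔸 := fun z κ => hG.le_U1 (hU₀ z κ)
  have hdev₀ : ‖B8Ineq132.plaqF U₀ μ ν x - 1‖ < εk1 * ((L : ℝ)⁻¹ * ((L : ℝ) ^ k)⁻¹) ^ 2 :=
    lt_of_le_of_lt (le_pdevOn h₀ hp) h32
  exact ineq38_lt_of_ineq190_layer boxB blkB dep pt dir box blk y₀ S h190₀ h190₁ hC hdist hrow hτ hστ y hη hη1 hL hd1 hG k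
    hU₀ hε hε' hflow hβ₀ hB₃ hδ0 hδε hs3 hs2 hs lo hi hlohi h32 V hV h15 hδ2 h33 hX hfar hH hu μ ν x hmv₀ hmv₁ hgeom hCB
    hδkε hM hR h10 hx hxμ hxν hS₁ hS₂ hε1 hrestr hdev₀

end CStar

end Literature.MathematicalPhysics.QuantumFieldTheory.Balaban1983to89.B14From190LayerSizes
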